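import Summits.QuantumFields.YangMills.Theorems.BalabanUVNodesN15KingModelFullPropagatorRiemannWeightedRate
import Summits.QuantumFields.YangMills.Theorems.BalabanUVNodesN15KingModelPotentialDressedDecay
import Summits.QuantumFields.YangMills.Theorems.BalabanUVNodesN15KingModelPotentialDressedRate

/-!
# BalabanUVNodes ∕ N15 — THE KING MODEL, PART 11d: THE TWO-SPACING LETTER OF THE FULL PERTURBATION `Δ^{(k)}_v − Δ^{(k)}` WITH DECAY IN THE
# UNIT SITES — `|E_{k+1}(v)(b, b′) − E_k(v)(b, b′)| ≤ c·(w₀ + ν₀)·(L^{−1∕2})^k·e^{−δ|b − b′|}` for every coherent potential tower in the window,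
# and the dressed minimiser's Theorem-3.3 decay along King's run (Track A, DAG node N15 = NE2; FAN-OUT v1.1 §N15 s3 «KING-MODEL RUNG»)

HONEST FRAMING.  Count-neutral kernel bookkeeping (cell `pub-ymgap`, seat `pub-ymgap-dag-n15-d` g8; `--supports stmt-QuantumFields-20292
--as helper` = K3⁗ `SpineGivenEndpointR13Sep`; lineage K3 19676 → K3′ 19908 → K3‴ 19912).  King's `A = 0` SCALAR block-spin tower ([King1986]
§2.2 (2.13)–(2.15) p. 653, §4 (4.5) p. 670) on the King-admissible unit tori `Π ℤ∕(2L^{e+1})` (odd `L ≥ 3`, `m² > 0`) dressed NONPERTURBATIVELY by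
a fine-lattice POTENTIAL TOWER; the potential is a multiplication operator, NOT a gauge field; nothing here is Bałaban's `Δ^{(k)}(U) − Δ^{(k)}(1)` ∕
`H_k(U)`; NOT a node discharge; nothing continuum ∕ ℝ⁴ ∕ OS ∕ mass-gap ∕ Clay.  0 `sorry`, 0 `def`, standard axioms.
THE POINT.  Part 10c derived the (3.36)∕(H3) SUP rate of the full perturbation; part 8b's letter for the FIRST variation was stronger — it kept the
decay `e^{−δ|b − b′|}` in the unit sites.  THIS FILE closes that gap for the full dressing, discharging part 11c's decaying letters along King's run
(8b `kingH_decay_kingU` ∕ `kingH_step_kingU`, 11a `fullProp_riemannMassW_unif`, 11b `fullProp_riemannRateW_unif`, window of 9a∕9c):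
* ★ **`kingHPot_decay_kingU`** — THE DRESSED MINIMISER OBEYS KING'S THEOREM 3.3 DECAY ALONG THE RUN: `∃ w̄, c, δ > 0 ∀ e ∀ k ≥ 1 ∀ N = L^k ∀ w` with
  `|w| ≤ w₀ ≤ w̄`: `|ℋ_{k,w}(x, b)| ≤ c·e^{−δ|B(x) − b|}` (constants uniform in `k`, the volume and the potential);
* ★★ **`fullPert_stepDecay_kingU`** — `∃ w̄₁₁, c, δ > 0 ∀ e ∀ v ∀ w₀ ν₀ s`, size `≤ w₀ ≤ w̄₁₁`, `0 ≤ s ≤ L^{−1∕2}`, coherence `(ν₀, s)`: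
  `∀ k ≥ 1 ∀ b b′, |E_{k+1}(v)(b, b′) − E_k(v)(b, b′)| ≤ c·(w₀ + ν₀)·(L^{−1∕2})^k·e^{−δ|b − b′|}` — part 8b's `potLevel_letters_kingU` two-spacing
  shape WITH decay, now for the FULL dressing.
HONEST SCOPE.  As part 10c: King-admissible tori only; rate `L^{−1∕2}`; window depends on `m²`; scalar potential, `A = 0`; not Bałaban's (3.36);
not a discharge.
Locators: [King1986] C. King, CMP **102** (1986) 649–677: (2.13)–(2.15) p. 653, Theorem 3.3 (3.7) p. 658 (PDF: p. 655, (3.7) p. 656), Prop. 3.8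
(3.71) p. 664 and p. 664 (pairing), Lemma 4.3 (4.18) p. 672, (4.39)–(4.41) p. 675; [B9] = [Balaban1985BackgroundPropagators] (3.35)–(3.36) p. 396.
-/

noncomputable section

open scoped BigOperators Matrix
open Finset

namespace Summit.QuantumFields.YangMills.BalabanUVNodes.N15.KingModel

open Literature.MathematicalPhysics.QuantumFieldTheory.Balaban1983to89 hiding blockOf
open Literature.MathematicalPhysics.QuantumFieldTheory.Balaban1983to89.B4Sect5Proof (latticeConst latticeConst_nonneg)
open Literature.MathematicalPhysics.QuantumFieldTheory.Balaban1983to89.B5Prop11Plancherel (Tor fine)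
open Literature.MathematicalPhysics.QuantumFieldTheory.King1986 (aK aK_pos)
open Literature.MathematicalPhysics.QuantumFieldTheory.King1986.Torus
open Summit.QuantumFields.YangMills.BalabanUVNodes.N15KingModelRung (kingH)
open Summit.QuantumFields.YangMills.BalabanUVNodes.N15KingModelRung.Curved (underPtN val_underPtN blockOf_underPtN)

variable {d : ℕ}

section DecayRun

open Real

variable (L : ℕ) [NeZero L]

/-- **THE DRESSED MINIMISER OBEYS KING'S THEOREM 3.3 DECAY ALONG THE RUN**: for odd `L ≥ 3`, `a, m² > 0` there are `w̄, c, δ > 0` such that for every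
volume exponent `e`, every `k ≥ 1` (any spelling `N = L^k`) and every potential `w` on the level-`k` fine torus with `|w| ≤ w₀ ≤ w̄`:
`|ℋ_{k,w}(x, b)| ≤ c·e^{−δ|B(x) − b|}` for all `x, b` (part 11c's weighted Neumann step on 8b's `kingH_decay_kingU` and 11a's weighted Riemann mass;
invertibility from 9a∕9c's window). [cite: King1986, (2.15) p.653, Theorem 3.3 (3.7) p.658] -/
theorem kingHPot_decay_kingU (hLodd : Odd L) (hL : 2 ≤ L) {a m2 : ℝ} (ha : 0 < a) (hm : 0 < m2) :
    ∃ wb c δ : ℝ, 0 < wb ∧ 0 < c ∧ 0 < δ ∧ ∀ (e k : ℕ), 1 ≤ k → ∀ (N : ℕ) [NeZero N], N = L ^ k →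
      ∀ (w : Tor (fine N (kingU d L e)) → ℝ) (w₀ : ℝ), (∀ y, |w y| ≤ w₀) → w₀ ≤ wb →
      ∀ (b : Tor (kingU d L e)) (x : Tor (fine N (kingU d L e))),
        |kingHPot L N (kingU d L e) a m2 k w b x| ≤ c * Real.exp (-(δ * tdistT (kingU d L e) (blockOf N (kingU d L e) x) b)) := by
  have hL1 : 1 < L := by omega
  have hLr : (1 : ℝ) < L := by exact_mod_cast hL1
  obtain ⟨δH, cH, hδH, hcH, HH⟩ := kingH_decay_kingU (d := d) L hLodd hL ha hm.le
  obtain ⟨δW, CW, hδW, hCW, HW⟩ := fullProp_riemannMassW_unif (d := d) L hLodd hL ha hm.le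
  obtain ⟨-, -, hwbar⟩ := dressedConsts_nonneg (d := d) ha hL
  set δ : ℝ := min δH δW with hδdef
  have hδ : 0 < δ := lt_min hδH hδW
  set wb : ℝ := min (wbarK (d + 1) a L) (1 / (2 * CW)) with hwbdef
  have hwb : 0 < wb := lt_min hwbar (by positivity)
  refine ⟨wb, 2 * cH, δ, hwb, by positivity, hδ, fun e k hk N _ hN w w₀ hw hwle b x => ?_⟩
  subst hN
  have hM' : ∀ μ, kingU d L e μ = 2 * L ^ (e + 1) := fun μ => by
    show L * (2 * L ^ e) = 2 * L ^ (e + 1)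
    ring
  have hak : 0 < aK a L k := aK_pos ha hLr hk
  have hwin : CW * w₀ ≤ 1 / 2 := by
    have h1 : w₀ ≤ 1 / (2 * CW) := hwle.trans (min_le_right _ _)
    rw [le_div_iff₀ (by positivity)] at h1
    linarith
  have hlo : ∀ y, -w₀ ≤ w y := fun y => (abs_le.mp (hw y)).1
  have hB : IsUnit (fineOpPot (L ^ k) (kingU d L e) (aK a L k) (((L ^ k : ℕ) : ℝ) ^ 2) m2 w) :=
    fineOpPot_isUnit hak.le hm.le hlo (by
      obtain ⟨-, -, hgap, -⟩ := gap_unif (d := d) ha hL hk (hwle.trans (min_le_left _ _))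
      have hP : 0 ≤ (2 * ((d + 1 : ℕ) : ℝ) + aK a L k) * (4 * kapCT (d + 1) a L) ^ 2 := by positivity
      linarith)
  have hHdec : ∀ (b : Tor (kingU d L e)) (y : Tor (fine (L ^ k) (kingU d L e))),
      |kingH L (L ^ k) (kingU d L e) a m2 k b y| ≤ cH * Real.exp (-(δ * tdistT (kingU d L e) (blockOf (L ^ k) (kingU d L e) y) b)) :=
    fun b y => decay_mono hcH.le (min_le_left _ _) ((tdistT_isPseudoDist (kingU d L e)).nonneg _ _) (HH e k hk (L ^ k) rfl b y)
  have hmassW : ∀ y : Tor (fine (L ^ k) (kingU d L e)), (((L ^ k : ℕ) : ℝ) ^ (d + 1))⁻¹ *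
      ∑ y', |constrainedProp (L ^ k) (kingU d L e) (aK a L k) (((L ^ k : ℕ) : ℝ) ^ 2) m2 y y'|
        * Real.exp (δ * tdistT (kingU d L e) (blockOf (L ^ k) (kingU d L e) y) (blockOf (L ^ k) (kingU d L e) y')) ≤ CW :=
    fun y => HW k hk δ hδ.le (min_le_right _ _) (L ^ k) rfl (e + 1) (kingU d L e) hM' m2 hm le_rfl y
  exact kingHPot_decay hak.le hm hB hcH.le hδ.le hHdec hmassW hw hwin b x

/-- **THE TWO-SPACING LETTER OF THE FULL PERTURBATION `Δ^{(k)}_v − Δ^{(k)}` WITH DECAY IN THE UNIT SITES** (part 8b's two-spacing shape for the FULL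
dressing): for odd `L ≥ 3`, `a, m² > 0` there are `w̄₁₁, c, δ > 0` such that for every volume exponent `e`, every potential tower `v` on the fine tori
over `Π ℤ∕(2L^{e+1})` with `sup_{N,x}|v_N(x)| ≤ w₀ ≤ w̄₁₁` and every coherence letter `|v_{L·L^k}(x′) − v_{L^k}(x)| ≤ ν₀·s^k` (`k ≥ 1`, `0 ≤ ν₀`,
`0 ≤ s ≤ L^{−1∕2}`), at every `k ≥ 1` and all unit sites `b, b′`:
`|E_{k+1}(v)(b, b′) − E_k(v)(b, b′)| ≤ c·(w₀ + ν₀)·(L^{−1∕2})^k·e^{−δ|b − b′|}` (`E(v) = fullPert a m² L (kingM d L e) v`).  Mechanism: part 11c's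
three decaying bounds discharged by 8b's minimiser letters, 11a∕11b's weighted Riemann bounds and the window of 9a∕9c, then part 10c's bookkeeping.
[cite: King1986, (2.13)–(2.15) p.653, Theorem 3.3 (3.7) p.658, Prop. 3.8 (3.71) p.664, Lemma 4.3 (4.18) p.672, (4.39)–(4.41) p.675; Balaban1985BackgroundPropagators, (3.36) p.396 (slot)] -/
theorem fullPert_stepDecay_kingU (hLodd : Odd L) (hL : 2 ≤ L) {a m2 : ℝ} (ha : 0 < a) (hm : 0 < m2) :
    ∃ wb c δ : ℝ, 0 < wb ∧ 0 < c ∧ 0 < δ ∧ ∀ (e : ℕ) (v : ∀ N : ℕ, Tor (fine N (kingU d L e)) → ℝ) (w₀ ν₀ s : ℝ),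
      (∀ (N : ℕ) (x : Tor (fine N (kingU d L e))), |v N x| ≤ w₀) → w₀ ≤ wb → 0 ≤ ν₀ → 0 ≤ s → s ≤ (L : ℝ) ^ (-(1 / 2 : ℝ)) →
      (∀ (k : ℕ), 1 ≤ k → ∀ x' : Tor (fine (L ^ 1 * L ^ k) (kingU d L e)),
          |v (L ^ 1 * L ^ k) x' - v (L ^ k) (underPtN L k 1 (kingU d L e) x')| ≤ ν₀ * s ^ k) →
      ∀ (k : ℕ), 1 ≤ k → ∀ b b' : Tor (kingU d L e),
        |(fullPert a m2 L (kingM d L e) v (k + 1) - fullPert a m2 L (kingM d L e) v k) b b'|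
          ≤ c * (w₀ + ν₀) * ((L : ℝ) ^ (-(1 / 2 : ℝ))) ^ k * Real.exp (-(δ * tdistT (kingU d L e) b b')) := by
  have hL1 : 1 < L := by omega
  have hLr : (1 : ℝ) < L := by exact_mod_cast hL1
  -- the letters: 8b (decaying, undressed), 11a∕11b (weighted Riemann bounds), the window of 9c
  obtain ⟨δH, cH, hδH, hcH, HH⟩ := kingH_decay_kingU (d := d) L hLodd hL ha hm.le
  obtain ⟨δS, CS, hδS, hCS, HS⟩ := kingH_step_kingU (d := d) L hLodd hL ha hm
  obtain ⟨δW, CW, hδW, hCW, HW⟩ := fullProp_riemannMassW_unif (d := d) L hLodd hL ha hm.le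
  obtain ⟨δR, CR, hδR, hCR, HR⟩ := fullProp_riemannRateW_unif (d := d) L hLodd hL ha hm.le (γ := 1) zero_le_one le_rfl
  obtain ⟨-, -, hwbar⟩ := dressedConsts_nonneg (d := d) ha hL
  obtain ⟨hr0, hr1, -⟩ := rate_facts L hL
  -- the common decay rate and the constants
  set δ : ℝ := min (min δH δS) (min δW δR) with hδdef
  have hδ : 0 < δ := lt_min (lt_min hδH hδS) (lt_min hδW hδR)
  have hδH' : δ ≤ δH := (min_le_left _ _).trans (min_le_left _ _)
  have hδS' : δ ≤ δS := (min_le_left _ _).trans (min_le_right _ _)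
  have hδW' : δ ≤ δW := (min_le_right _ _).trans (min_le_left _ _)
  have hδR' : δ ≤ δR := (min_le_right _ _).trans (min_le_right _ _)
  set Kδ : ℝ := latticeConst (d + 1) (δ / 2) with hKδ
  have hKδ0 : 0 ≤ Kδ := latticeConst_nonneg (d + 1) (half_pos hδ).le
  set wb : ℝ := min (wbarK (d + 1) a L) (1 / (2 * CW)) with hwbdef
  have hwb : 0 < wb := lt_min hwbar (by positivity)
  set c : ℝ := Kδ * (4 * cH * CS + 2 * cH ^ 2 + 4 * cH ^ 2 * CR * wb + 4 * cH ^ 2 * CW * wb) + 1 with hcdef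
  have hc : 0 < c := by positivity
  refine ⟨wb, c, δ / 2, hwb, hc, half_pos hδ, fun e v w₀ ν₀ s hv hw hν₀ hs0 hs1 hcoh k hk1 z z' => ?_⟩
  set r : ℝ := (L : ℝ) ^ (-(1 / 2 : ℝ)) with hrdef
  have hw₀ : 0 ≤ w₀ := (abs_nonneg _).trans (hv 0 fun _ => 0)
  have hM' : ∀ μ, kingU d L e μ = 2 * L ^ (e + 1) := fun μ => by
    show L * (2 * L ^ e) = 2 * L ^ (e + 1)
    ring
  have hN' : L ^ 1 * L ^ k = L ^ (k + 1) := by ring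
  have hak : 0 < aK a L k := aK_pos ha hLr hk1
  have hak' : 0 < aK a L (k + 1) := aK_pos ha hLr (by omega)
  -- sizes and the window
  have hwbar' : w₀ ≤ wbarK (d + 1) a L := hw.trans (min_le_left _ _)
  have hwin : CW * w₀ ≤ 1 / 2 := by
    have h1 : w₀ ≤ 1 / (2 * CW) := hw.trans (min_le_right _ _)
    rw [le_div_iff₀ (by positivity)] at h1
    linarith
  have hlo : ∀ (N : ℕ) (x : Tor (fine N (kingU d L e))), -w₀ ≤ v N x := fun N x => (abs_le.mp (hv N x)).1
  have hB : IsUnit (fineOpPot (L ^ k) (kingU d L e) (aK a L k) (((L ^ k : ℕ) : ℝ) ^ 2) m2 (v (L ^ k))) :=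
    fineOpPot_isUnit hak.le hm.le (hlo (L ^ k)) (by
      obtain ⟨-, -, hgap, -⟩ := gap_unif (d := d) ha hL hk1 hwbar'
      have hP : 0 ≤ (2 * ((d + 1 : ℕ) : ℝ) + aK a L k) * (4 * kapCT (d + 1) a L) ^ 2 := by positivity
      linarith)
  have hB' : IsUnit (fineOpPot (L ^ 1 * L ^ k) (kingU d L e) (aK a L (k + 1)) (((L ^ 1 * L ^ k : ℕ) : ℝ) ^ 2) m2 (v (L ^ 1 * L ^ k))) :=
    fineOpPot_isUnit hak'.le hm.le (hlo (L ^ 1 * L ^ k)) (by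
      obtain ⟨-, -, hgap, -⟩ := gap_unif (d := d) ha hL (by omega : 1 ≤ k + 1) hwbar'
      have hP : 0 ≤ (2 * ((d + 1 : ℕ) : ℝ) + aK a L (k + 1)) * (4 * kapCT (d + 1) a L) ^ 2 := by positivity
      linarith)
  -- the decaying letters of the undressed minimiser at the common rate `δ`, both runs
  have hHdec : ∀ (b : Tor (kingU d L e)) (x : Tor (fine (L ^ k) (kingU d L e))),
      |kingH L (L ^ k) (kingU d L e) a m2 k b x| ≤ cH * Real.exp (-(δ * tdistT (kingU d L e) (blockOf (L ^ k) (kingU d L e) x) b)) :=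
    fun b x => decay_mono hcH.le hδH' ((tdistT_isPseudoDist (kingU d L e)).nonneg _ _) (HH e k hk1 (L ^ k) rfl b x)
  have hHdec' : ∀ (b : Tor (kingU d L e)) (x' : Tor (fine (L ^ 1 * L ^ k) (kingU d L e))),
      |kingH L (L ^ 1 * L ^ k) (kingU d L e) a m2 (k + 1) b x'|
        ≤ cH * Real.exp (-(δ * tdistT (kingU d L e) (blockOf (L ^ 1 * L ^ k) (kingU d L e) x') b)) :=
    fun b x' => decay_mono hcH.le hδH' ((tdistT_isPseudoDist (kingU d L e)).nonneg _ _) (HH e (k + 1) (by omega) (L ^ 1 * L ^ k) hN' b x')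
  have hstep : ∀ (b : Tor (kingU d L e)) (x' : Tor (fine (L ^ 1 * L ^ k) (kingU d L e))),
      |kingH L (L ^ 1 * L ^ k) (kingU d L e) a m2 (k + 1) b x' - kingH L (L ^ k) (kingU d L e) a m2 k b (underPtN L k 1 (kingU d L e) x')|
        ≤ CS * r ^ k * Real.exp (-(δ * tdistT (kingU d L e) (blockOf (L ^ 1 * L ^ k) (kingU d L e) x') b)) :=
    fun b x' => decay_mono (by positivity) hδS' ((tdistT_isPseudoDist (kingU d L e)).nonneg _ _) (HS e k hk1 b x')
  -- the weighted Riemann bounds of parts 11a∕11b at the rate `δ`, both runs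
  have hmassW : ∀ x : Tor (fine (L ^ k) (kingU d L e)), (((L ^ k : ℕ) : ℝ) ^ (d + 1))⁻¹ *
      ∑ y, |constrainedProp (L ^ k) (kingU d L e) (aK a L k) (((L ^ k : ℕ) : ℝ) ^ 2) m2 x y|
        * Real.exp (δ * tdistT (kingU d L e) (blockOf (L ^ k) (kingU d L e) x) (blockOf (L ^ k) (kingU d L e) y)) ≤ CW :=
    fun x => HW k hk1 δ hδ.le hδW' (L ^ k) rfl (e + 1) (kingU d L e) hM' m2 hm le_rfl x
  have hmassW' : ∀ x' : Tor (fine (L ^ 1 * L ^ k) (kingU d L e)), (((L ^ 1 * L ^ k : ℕ) : ℝ) ^ (d + 1))⁻¹ *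
      ∑ y', |constrainedProp (L ^ 1 * L ^ k) (kingU d L e) (aK a L (k + 1)) (((L ^ 1 * L ^ k : ℕ) : ℝ) ^ 2) m2 x' y'|
        * Real.exp (δ * tdistT (kingU d L e) (blockOf (L ^ 1 * L ^ k) (kingU d L e) x') (blockOf (L ^ 1 * L ^ k) (kingU d L e) y')) ≤ CW :=
    fun x' => HW (k + 1) (by omega) δ hδ.le hδW' (L ^ 1 * L ^ k) hN' (e + 1) (kingU d L e) hM' m2 hm le_rfl x'
  have hrateW : ∀ x' : Tor (fine (L ^ 1 * L ^ k) (kingU d L e)), (((L ^ 1 * L ^ k : ℕ) : ℝ) ^ (d + 1))⁻¹ *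
      ∑ y', |constrainedProp (L ^ 1 * L ^ k) (kingU d L e) (aK a L (k + 1)) (((L ^ 1 * L ^ k : ℕ) : ℝ) ^ 2) m2 x' y'
        - constrainedProp (L ^ k) (kingU d L e) (aK a L k) (((L ^ k : ℕ) : ℝ) ^ 2) m2 (underPtN L k 1 (kingU d L e) x')
          (underPtN L k 1 (kingU d L e) y')|
        * Real.exp (δ * tdistT (kingU d L e) (blockOf (L ^ k) (kingU d L e) (underPtN L k 1 (kingU d L e) x'))
          (blockOf (L ^ k) (kingU d L e) (underPtN L k 1 (kingU d L e) y'))) ≤ CR * r ^ k := by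
    intro x'
    exact HR k hk1 δ hδ.le hδR' 1 le_rfl (e + 1) (kingU d L e) hM' m2 hm le_rfl x'
  -- sizes of the two potentials and the coherence defect
  have hwk : ∀ y, |v (L ^ k) y| ≤ w₀ := hv (L ^ k)
  have hwk' : ∀ y', |v (L ^ 1 * L ^ k) y'| ≤ w₀ := hv (L ^ 1 * L ^ k)
  have hcohk := hcoh k hk1
  -- the dressed DECAY (11c §1) and the dressed step WITH DECAY (11c §2) at the finer run
  have hH' : ∀ (b : Tor (kingU d L e)) (y' : Tor (fine (L ^ 1 * L ^ k) (kingU d L e))),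
      |kingHPot L (L ^ 1 * L ^ k) (kingU d L e) a m2 (k + 1) (v (L ^ 1 * L ^ k)) b y'|
        ≤ 2 * cH * Real.exp (-(δ * tdistT (kingU d L e) (blockOf (L ^ 1 * L ^ k) (kingU d L e) y') b)) :=
    fun b y' => kingHPot_decay hak'.le hm hB' hcH.le hδ.le hHdec' hmassW' hwk' hwin b y'
  have hSd : ∀ (b : Tor (kingU d L e)) (y' : Tor (fine (L ^ 1 * L ^ k) (kingU d L e))),
      |kingHPot L (L ^ 1 * L ^ k) (kingU d L e) a m2 (k + 1) (v (L ^ 1 * L ^ k)) b y'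
          - kingHPot L (L ^ k) (kingU d L e) a m2 k (v (L ^ k)) b (underPtN L k 1 (kingU d L e) y')|
        ≤ 2 * (CS * r ^ k + CR * r ^ k * (w₀ * (2 * cH)) + CW * (ν₀ * s ^ k * (2 * cH)))
          * Real.exp (-(δ * tdistT (kingU d L e) (blockOf (L ^ 1 * L ^ k) (kingU d L e) y') b)) :=
    fun b y' => kingHPot_step_decay L hak.le hak'.le hm hB hB' (by positivity) hCW.le (by positivity) (by positivity) hδ.le
      hstep hmassW hrateW hwk hwk' hcohk hwin hH' b y'
  -- the entry of the difference, read at the fine count `L·L^k`, and part 11c §3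
  have hN'' : L ^ (k + 1) = L ^ 1 * L ^ k := hN'.symm
  rw [Matrix.sub_apply, fullPert_of_one_le v (by omega : 1 ≤ k + 1), fullPert_of_one_le v hk1,
    kingLevelPot_sub_congr v hN'', kingLevelPot_sub_congr v (rfl : L ^ k = L ^ k)]
  have hmain := effLaplacianPot_sub_step_decay L hak.le hak'.le hm hB hB' hcH.le (by positivity : 0 ≤ CS * r ^ k) hδ
    (by positivity : 0 ≤ 2 * cH) (by positivity) hHdec hstep hwk hwk' hcohk hH' hSd z z'
  refine hmain.trans ?_
  -- bookkeeping (part 10c's `rate_bookkeeping` with `K = K_{d+1}(δ∕2)`), times the decay factor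
  have hsr : s ^ k ≤ r ^ k := pow_le_pow_left₀ hs0 hs1 k
  have hbk := rate_bookkeeping (K := Kδ) (t := r ^ k) hKδ0 hcH.le hCS.le hCR.le hCW.le hw₀ hν₀ (pow_nonneg hs0 k) hw hsr
  have hE0 : 0 ≤ Real.exp (-(δ / 2 * tdistT (kingU d L e) z z')) := (Real.exp_pos _).le
  have hWr : 0 ≤ (w₀ + ν₀) * r ^ k := by positivity
  have hle : Kδ * (4 * cH * CS + 2 * cH ^ 2 + 4 * cH ^ 2 * CR * wb + 4 * cH ^ 2 * CW * wb) ≤ c := by rw [hcdef]; linarith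
  calc (CS * r ^ k * (w₀ * (2 * cH)) + cH * (ν₀ * s ^ k * (2 * cH)
          + w₀ * (2 * (CS * r ^ k + CR * r ^ k * (w₀ * (2 * cH)) + CW * (ν₀ * s ^ k * (2 * cH))))))
        * latticeConst (d + 1) (δ / 2) * Real.exp (-(δ / 2 * tdistT (kingU d L e) z z'))
      = Kδ * (CS * r ^ k * (w₀ * (2 * cH)) + cH * (ν₀ * s ^ k * (2 * cH)
          + w₀ * (2 * (CS * r ^ k + CR * r ^ k * (w₀ * (2 * cH)) + CW * (ν₀ * s ^ k * (2 * cH))))))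
        * Real.exp (-(δ / 2 * tdistT (kingU d L e) z z')) := by rw [hKδ]; ring
    _ ≤ Kδ * (4 * cH * CS + 2 * cH ^ 2 + 4 * cH ^ 2 * CR * wb + 4 * cH ^ 2 * CW * wb) * (w₀ + ν₀) * r ^ k
        * Real.exp (-(δ / 2 * tdistT (kingU d L e) z z')) := mul_le_mul_of_nonneg_right hbk hE0
    _ ≤ c * (w₀ + ν₀) * r ^ k * Real.exp (-(δ / 2 * tdistT (kingU d L e) z z')) := by
        refine mul_le_mul_of_nonneg_right ?_ hE0
        calc _ = Kδ * (4 * cH * CS + 2 * cH ^ 2 + 4 * cH ^ 2 * CR * wb + 4 * cH ^ 2 * CW * wb) * ((w₀ + ν₀) * r ^ k) := by ring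
          _ ≤ c * ((w₀ + ν₀) * r ^ k) := mul_le_mul_of_nonneg_right hle hWr
          _ = c * (w₀ + ν₀) * r ^ k := by ring

end DecayRun

end Summit.QuantumFields.YangMills.BalabanUVNodes.N15.KingModel

end
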